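import Literature.NumberTheory.Automorphic.BrandtModuleProofs
import HarnessLib

/-!
# Sub-ideals of given index and the chain formula for products of Brandt matrices

Second layer of the proof files for the named fact `brandtMatrix_comm` of `BrandtModule.lean`
(Vignéras, LNM 800, Ch. III §5 ex. 5.8 (c)–(d); Eichler 1973, II §6 Thm. 2 (18)–(19)), on top of
the sibling `BrandtModuleProofs.lean` (multiplicativity for coprime arguments). Generic
bookkeeping behind the *same-prime* identities between Brandt matrices `T(n) = B(n)` of a
`ℤ`-order `O` (`BrandtData.ofOrder`), in particular the Hecke recursion
`B(p^a) B(p) = B(p^{a+1}) + c B(p^{a-1})`: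

* `relIndex_ne_zero_of_isFullLattice` (a full sublattice of a finitely generated lattice has
  finite index) and `finite_setOf_le_and_relIndex_eq` (finitely many sublattices of given index;
  cf. `finite_subideals` of `BrandtModuleProofs.lean`, whose `zsmul_relIndex_mem` is used);
* `Subideal O I n` — the type of invertible right `O`-ideals `M ⊆ I` with `[I : M] = n²`, the
  set counted (class by class) by the Brandt matrix entry `B(n)_{[I] j}`; it is finite
  (`Subideal.finite`), empty for `n = 0` (`Subideal.isEmpty_zero`), whence **`B(0) = 0`**
  (`BrandtData.ofOrder_T_zero`);
* the **chain formula** `BrandtData.ofOrder_T_mul_T_apply`: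
  `(B(m) B(n))_{ik} = #{(M, N) : I_i ⊇ M ⊇ N, [I_i : M] = m², [M : N] = n², [N] = k}` — the
  product of two Brandt matrices counts two-step chains of sub-ideals (Eichler 1973, II §6,
  proof of Thm. 2, (23)–(25); this is the form in which both the multiplicativity
  `B(mn) = B(m) B(n)` and the Hecke recursion are proved).

## References

* M. Eichler, *The basis problem for modular forms and the traces of the Hecke operators*,
  LNM 320 (1973), Ch. II §6, Thm. 2 and its proof [Eichler1973].
* M.-F. Vignéras, *Arithmétique des algèbres de quaternions*, LNM 800 (1980), Ch. III §5
  exercice 5.8 [VignerasLNM800].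
-/

noncomputable section

open scoped Pointwise

universe u

namespace Literature.NumberTheory.Automorphic

/-! ### Indices of sublattices -/

section Index

variable {B : Type u} [Ring B]

variable [IsAddTorsionFree B]

/-- A full lattice has finite (non-zero) index in any finitely generated lattice containing…
or not containing it: `[I : M] ≠ 0` (`relIndex` counts `I / (I ∩ M)`). [folklore] -/
theorem relIndex_ne_zero_of_isFullLattice {M I : Submodule ℤ B} (hM : IsFullLattice B M)
    (hI : I.FG) : M.toAddSubgroup.relIndex I.toAddSubgroup ≠ 0 := by
  obtain ⟨n, hn, hnI⟩ := exists_smul_mem_of_fg hM hI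
  exact relIndex_ne_zero_of_smul_mem I hI hn M hnI

/-- **Finitely many sublattices of given finite index** in a finitely generated lattice of a
torsion-free ring. [folklore] -/
theorem finite_setOf_le_and_relIndex_eq (I : Submodule ℤ B) (hI : I.FG) {e : ℕ} (he : e ≠ 0) :
    {M : Submodule ℤ B | M ≤ I ∧ M.toAddSubgroup.relIndex I.toAddSubgroup = e}.Finite := by
  refine (finite_setOf_le_and_smul_mem I hI (n := (e : ℤ)) (by exact_mod_cast he)).subset ?_
  rintro M ⟨hMI, hidx⟩
  refine ⟨hMI, fun x hx => ?_⟩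
  have h := zsmul_relIndex_mem (M := M) (I := I) hx
  rwa [hidx] at h

end Index

/-! ### Sub-ideals of index `n²` -/

section Subideal

variable {B : Type u} [Ring B]

/-- **The sub-ideals counted by a Brandt matrix entry**: for a `ℤ`-order `O`, a lattice `I` and
`n : ℕ`, `Subideal O I n` is the type of invertible right `O`-ideals `M ⊆ I` with `[I : M] = n²`
(i.e. of reduced norm `n · nrd I`; Eichler 1973 II §6 (14)–(15), Vignéras III ex. 5.8). The
entry `B(n)_{[I] j}` is the number of those of class `j` (`subidealCount_eq_card`). [cite: Eichler1973, Ch. II §6 (14)–(15)] -/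
def Subideal (O I : Submodule ℤ B) (n : ℕ) : Type u :=
  {M : invertibleRightIdeals O // (M : Submodule ℤ B) ≤ I ∧
    (M : Submodule ℤ B).toAddSubgroup.relIndex I.toAddSubgroup = n ^ 2}

namespace Subideal

variable {O I : Submodule ℤ B} {n : ℕ}

/-- The underlying lattice of a sub-ideal. [folklore] -/
theorem le (M : Subideal O I n) : ((M.1 : invertibleRightIdeals O) : Submodule ℤ B) ≤ I := M.2.1

/-- The index condition of a sub-ideal. [folklore] -/
theorem relIndex_eq (M : Subideal O I n) :
    ((M.1 : invertibleRightIdeals O) : Submodule ℤ B).toAddSubgroup.relIndex I.toAddSubgroup =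
      n ^ 2 := M.2.2

/-- A sub-ideal is an invertible right `O`-ideal. [folklore] -/
theorem isInvertibleRightIdeal (M : Subideal O I n) :
    IsInvertibleRightIdeal O ((M.1 : invertibleRightIdeals O) : Submodule ℤ B) := M.1.2

/-- Two sub-ideals with the same underlying lattice are equal. [folklore] -/
@[ext] theorem ext {M M' : Subideal O I n}
    (h : ((M.1 : invertibleRightIdeals O) : Submodule ℤ B) = (M'.1 : Submodule ℤ B)) : M = M' :=
  Subtype.ext (Subtype.ext h)

/-- `n² I ⊆ M` for a sub-ideal `M` of index `n²` (Lagrange). [folklore] -/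
theorem smul_mem (M : Subideal O I n) {x : B} (hx : x ∈ I) :
    ((n ^ 2 : ℕ) : ℤ) • x ∈ ((M.1 : invertibleRightIdeals O) : Submodule ℤ B) := by
  have h := zsmul_relIndex_mem (M := ((M.1 : invertibleRightIdeals O) : Submodule ℤ B)) (I := I) hx
  rwa [M.relIndex_eq] at h

variable [IsAddTorsionFree B]

/-- There is no sub-ideal of index `0² = 0` in a finitely generated lattice (a full sublattice
has finite index). [folklore] -/
theorem isEmpty_zero (hI : I.FG) : IsEmpty (Subideal O I 0) :=
  ⟨fun M => relIndex_ne_zero_of_isFullLattice M.isInvertibleRightIdeal.isFullLattice hI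
    (by rw [M.relIndex_eq]; rfl)⟩

/-- **Finiteness**: a finitely generated lattice has finitely many invertible sub-ideals of
index `n²`. [folklore] -/
theorem finite (hI : I.FG) (n : ℕ) : Finite (Subideal O I n) := by
  rcases Nat.eq_zero_or_pos n with rfl | hn
  · haveI := isEmpty_zero (O := O) hI
    infer_instance
  · haveI := (finite_setOf_le_and_relIndex_eq I hI (e := n ^ 2) (pow_ne_zero 2 hn.ne')).to_subtype
    refine Finite.of_injective
      (fun M : Subideal O I n => (⟨((M.1 : invertibleRightIdeals O) : Submodule ℤ B), M.le,
        M.relIndex_eq⟩ : {M : Submodule ℤ B | M ≤ I ∧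
          M.toAddSubgroup.relIndex I.toAddSubgroup = n ^ 2})) fun M M' h => ?_
    exact Subideal.ext (by simpa using congrArg Subtype.val h)

end Subideal

/-- **The Brandt matrix entry counts sub-ideals**: `B_{[I] j}(n) = #{M ∈ Subideal O I n : [M] = j}`
(a reassociation of the definition `subidealCount`). [cite: Eichler1973, Ch. II §6 (14)–(15)] -/
theorem subidealCount_eq_card (O I : Submodule ℤ B) (n : ℕ) (j : RightIdealClass O) :
    subidealCount O I n j = Nat.card {M : Subideal O I n // RightIdealClass.mk M.1 = j} := by
  unfold subidealCount Subideal
  refine Nat.card_congr ((Equiv.subtypeEquivRight fun M => ?_).trans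
    (Equiv.subtypeSubtypeEquivSubtypeInter
      (fun M : invertibleRightIdeals O => (M : Submodule ℤ B) ≤ I ∧
        (M : Submodule ℤ B).toAddSubgroup.relIndex I.toAddSubgroup = n ^ 2)
      (fun M => RightIdealClass.mk M = j)).symm)
  exact and_assoc.symm

/-- The sub-ideal counts may be computed on the canonical representative of the class of any
invertible ideal: `B_{[rep [M]] k}(n) = B_{[M] k}(n)` computed on `M`. [folklore] -/
theorem subidealCount_rep_mk {O : Submodule ℤ B} (M : invertibleRightIdeals O) (n : ℕ)
    (k : RightIdealClass O) :
    subidealCount O (RightIdealClass.rep (RightIdealClass.mk M)) n k = subidealCount O M n k := by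
  obtain ⟨b, hb⟩ := RightIdealClass.exists_rep_mk_eq M
  rw [hb, subidealCount_units_smul]

end Subideal

/-! ### Brandt matrices: `B(0) = 0` and the chain formula -/

section OfOrder

variable {B : Type u} [Ring B] [Algebra ℚ B] [IsQuaternionAlgebra ℚ B] {O : Submodule ℤ B}

omit [IsQuaternionAlgebra ℚ B] in
/-- In a `ℚ`-algebra there is no sub-ideal of index `0` of a representative ideal. [folklore] -/
theorem subidealCount_zero (I : invertibleRightIdeals O) (j : RightIdealClass O) :
    subidealCount O I 0 j = 0 := by
  haveI : IsAddTorsionFree B := isAddTorsionFree_of_charZero_module ℚ B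
  haveI := Subideal.isEmpty_zero (O := O) (I := (I : Submodule ℤ B)) I.2.isFullLattice.1
  rw [subidealCount_eq_card]
  exact Nat.card_of_isEmpty

/-- **`B(0) = 0`**: there are no sub-ideals of infinite index (`relIndex = 0`) in a full lattice,
so the Brandt matrix of `0` of any `ℤ`-order in a quaternion algebra over `ℚ` vanishes (the
documented junk value of `BrandtData.ofOrder` at `n = 0`). [folklore] -/
theorem BrandtData.ofOrder_T_zero (hO : IsZOrder O) : (BrandtData.ofOrder O hO).T 0 = 0 := by
  ext i j
  rw [BrandtData.ofOrder_T, Matrix.zero_apply,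
    ← RightIdealClass.mk_rep i, subidealCount_rep_mk, subidealCount_zero, Nat.cast_zero]

/-- The type of **two-step chains** `I ⊇ M ⊇ N` of invertible right `O`-ideals with
`[I : M] = m²`, `[M : N] = n²` and `N` of class `k`. [folklore] -/
abbrev Chain (O I : Submodule ℤ B) (m n : ℕ) (k : RightIdealClass O) : Type u :=
  Σ M : Subideal O I m, {N : Subideal O ((M.1 : invertibleRightIdeals O) : Submodule ℤ B) n //
    RightIdealClass.mk N.1 = k}

/-- **Chain formula** (Eichler 1973, II §6, proof of Thm. 2): the `(i, k)` entry of the product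
`B(m) B(n)` of two Brandt matrices of a `ℤ`-order `O` is the number of chains
`I_i ⊇ M ⊇ N` of invertible right `O`-ideals with `[I_i : M] = m²`, `[M : N] = n²` and `[N] = k`
— because `B(n)_{jk}` may be computed on any ideal `M` of class `j` (`BrandtData.ofOrder_T_mk`). [cite: Eichler1973, Ch. II §6 Thm. 2 (proof)] -/
theorem BrandtData.ofOrder_T_mul_T_apply (hO : IsZOrder O) (m n : ℕ) (i k : RightIdealClass O) :
    ((BrandtData.ofOrder O hO).T m * (BrandtData.ofOrder O hO).T n) i k =
      Nat.card (Chain O (RightIdealClass.rep i) m n k) := by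
  classical
  haveI : IsAddTorsionFree B := isAddTorsionFree_of_charZero_module ℚ B
  letI : Fintype (RightIdealClass O) := (BrandtData.ofOrder O hO).instFintype
  have hIfg : (RightIdealClass.rep i).FG := (RightIdealClass.isInvertibleRightIdeal_rep i).isFullLattice.1
  haveI : Finite (Subideal O (RightIdealClass.rep i) m) := Subideal.finite hIfg m
  letI : Fintype (Subideal O (RightIdealClass.rep i) m) := Fintype.ofFinite _
  haveI : ∀ M : Subideal O (RightIdealClass.rep i) m,
      Finite {N : Subideal O ((M.1 : invertibleRightIdeals O) : Submodule ℤ B) n //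
        RightIdealClass.mk N.1 = k} := fun M =>
    haveI := Subideal.finite (O := O) (I := ((M.1 : invertibleRightIdeals O) : Submodule ℤ B))
      M.isInvertibleRightIdeal.isFullLattice.1 n
    inferInstance
  -- everything in `ℕ`
  suffices h : ∑ j, subidealCount O (RightIdealClass.rep i) m j *
      subidealCount O (RightIdealClass.rep j) n k = Nat.card (Chain O (RightIdealClass.rep i) m n k) by
    rw [Matrix.mul_apply]
    simp only [BrandtData.ofOrder_T]
    exact_mod_cast h
  rw [Nat.card_sigma]
  -- replace `B(m)_{ij}` by a sum of ones over the sub-ideals of class `j`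
  have hcount : ∀ j, subidealCount O (RightIdealClass.rep i) m j =
      ∑ M : {M : Subideal O (RightIdealClass.rep i) m // RightIdealClass.mk M.1 = j}, 1 := fun j => by
    rw [subidealCount_eq_card, Nat.card_eq_fintype_card, Fintype.card_eq_sum_ones]
  simp_rw [hcount, Finset.sum_mul, one_mul]
  -- `B(n)_{jk}` computed on `M` when `[M] = j`
  have hfib : ∀ j, ∀ M : {M : Subideal O (RightIdealClass.rep i) m // RightIdealClass.mk M.1 = j},
      subidealCount O (RightIdealClass.rep j) n k =
        subidealCount O ((M.1.1 : invertibleRightIdeals O) : Submodule ℤ B) n k := fun j M => by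
    have h := subidealCount_rep_mk (M.1.1 : invertibleRightIdeals O) n k
    rw [M.2] at h
    exact h
  rw [Finset.sum_congr rfl fun j _ => Finset.sum_congr rfl fun M _ => hfib j M]
  rw [Fintype.sum_fiberwise (fun M : Subideal O (RightIdealClass.rep i) m => RightIdealClass.mk M.1)
    (fun M => subidealCount O ((M.1 : invertibleRightIdeals O) : Submodule ℤ B) n k)]
  exact Finset.sum_congr rfl fun M _ => subidealCount_eq_card O _ n k

end OfOrder

end Literature.NumberTheory.Automorphic

end
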